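import Literature.NumberTheory.EllipticCurves.CongruentNewformWeightTwoMultiplierProofs
import Literature.NumberTheory.EllipticCurves.CuspFormLFunctionDeligneNonvanishingProofs
import Literature.NumberTheory.EllipticCurves.CuspFormLFunctionMeanSquareNonvanishingProofs
import Summits.BirchSwinnertonDyer.BirchSwinnertonDyer.Theorems.SignedLowerHalvesKobayashiLowerHalfLargeImageEdgeSeedCompanion
import HarnessLib

/-!
# Crux `KobayashiLowerHalfLargeImage` (item stmt-BirchSwinnertonDyer-19001), idea `edge-seed-rigidity`:
# its first stub `stub_companionEdge` AT `p = 3` — the weight-`4` COMPANION NEWFORM `g ≡ f_E (mod 𝔭)`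
# with `L(g, 3) ≠ 0` — on the curves whose conductor has a divisor `M ≢ 1 (mod 3)`

HONEST FRAMING (D-0152). Route K3 = `SignedLowerHalves` is a CLASS route; crux 3
(`Theses.SignedLowerHalves.KobayashiLowerHalfLargeImage`) is the Eisenstein half of Kobayashi's signed
main conjecture on the large-image corner of X7. NOTHING here proves the crux, the route, or BSD. This
file is a HELPER of item 19001 (`--supports`): the companion file
`SignedLowerHalvesKobayashiLowerHalfLargeImageEdgeSeedCompanion.lean` put the first stub
`S1 = stub_companionEdge` of the (unregistered, PREVIEW) line `Lines/edge_seed_rigidity.md` in the kernel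
at every prime `p ≥ 5` and recorded that `p = 3` was out of reach of the tree's Deligne–Serre step
(multiplication by the LEVEL-ONE Eisenstein series `E_{p−1}`; `E_2` is not modular). This file closes
that gap on an explicit population, by COMPOSING theorems PROVED in the tree — no new definition, no
`sorry`; the only named facts are the two already attached to S1 (Modularity, for the `f`-free form)
and to the edge value at `p = 3` (Deligne's bound, for `L(g, 3) ≠ 0` at Hecke's boundary `re s = k/2 + 1`):

* `ModularForms.exists_isNewform0_dvd_level_congr_weight_add_two`
  (`Literature/…/CongruentNewformWeightTwoMultiplierProofs`): the Deligne–Serre congruence run with the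
  genuine WEIGHT-TWO form `Φ_M/(1 − M)`, `Φ_M = E₂(τ) − M E₂(Mτ) ∈ M₂(Γ₀(M))` (Diamond–Shurman §1.2; the
  tree's `phiE2ModularForm`), whose `q`-expansion is `≡ 1 (mod 3)` exactly when `3 ∤ (1 − M)`: for a
  newform `f ∈ S_2(Γ₀(N))` and a divisor `M ∣ N` with `3 ∤ (M − 1)`, a newform `g ∈ S_4(Γ₀(M′))`,
  `M′ ∣ N`, with `a_q(g) ≡ a_q(f) (mod 𝔪_{ℚ̄_3})` for every prime `q ∤ N`;
* `ModularForms.IsNewform0.cuspFormLSeries_edge_ne_zero_of_deligne`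
  (`CuspFormLFunctionDeligneNonvanishingProofs`): `L(g, k − 1) ≠ 0` for a newform of weight `k ≥ 4`,
  GRANTED the named fact `Deligne1974_heckeT_eigenvalue_norm_le` (Deligne 1974, Thm. 8.2) — at weight `4`
  the edge value `s = 3` sits ON the boundary `re s = k/2 + 1` of Hecke's zero-free half-plane, which the
  unconditional `IsNewform0.cuspFormLSeries_ne_zero` (`re s > k/2 + 1`) misses;
* the modularity dictionary exactly as in the companion file (`IsNewformOf`,
  `LFunction_apply_prime_eq_frobeniusTrace`, `not_dvd_level_of_isNewformOf`,
  `hasGoodReductionAtPrime_of_not_dvd_conductorNorm`, `IsNewform0.heckeEigenvalue_eq_coeff_holds`,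
  `PadicAlgCl.nonempty_ringEquiv_complex`).

## Statements

* `exists_companion_newform_weight_add_two_of_isNewformOf` — `p ∈ {2, 3}` (`p ∣ 24`), unconditional:
  for `W/ℚ` globally minimal with good reduction at `p`, `f` its newform, and a divisor `M ∣ N_W` with
  `p ∤ (1 − M)`: `M′ ∣ N_W` with `p ∤ M′`, a newform `g ∈ S_4(Γ₀(M′))` and `ι : ℚ̄_p ≃ ℂ` with
  `‖ι⁻¹ a_ℓ(g) − a_ℓ(W)‖ < 1` for every prime `ℓ ∤ N_W`.
* `exists_companionEdge_of_isNewformOf_three` — the EDGE case at `p = 3`, granted Deligne's bound: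
  the weight-`4` companion with `L(g, 3) ≠ 0`, on `{3 good, ∃ M ∣ N_W, 3 ∤ (1 − M)}`.
* `stub_companionEdge_three_of_exists_isNewformOf` — the ideator's stub `stub_companionEdge` VERBATIM
  (definitions of the evidence file `Sketch.lean` UNFOLDED as in the companion file) with `p ≠ 2`
  specialised to `p = 3` and the population hypothesis `∃ M ∣ N_W, ¬ 3 ∣ (1 − M)` ADDED, granted the
  Modularity Theorem (`exists_isNewformOf`, BCDT 2001 Thm. A) and Deligne's bound
  (`Deligne1974_heckeT_eigenvalue_norm_le`, Deligne 1974 Thm. 8.2). The displayed `ClassX7 W p` is used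
  only through good reduction at `p`; `a_p = 0`, `Surj W p` are idle (honest: S1 does not need them).

## What is NOT proved here (said, not hidden)

* `p = 3` on the RESIDUAL population «every divisor of `N_W` is `≡ 1 (mod 3)`» (equivalently every
  bad prime of `W` is `≡ 1 (mod 3)`; e.g. `N_W = 7, 13, 19, 37, 49, 91, …`): no weight-two Eisenstein
  series of level `N_W` is `≡ 1 (mod 3)` (`Φ_M ≡ 1 − M ≡ 0`), and the weight-`4` companion there needs
  the Hasse invariant / Katz–Serre weight raising by `θ`-cycles, not in the tree.
* Together with the companion file, S1 is now in the kernel at: every `p ≥ 5` (unconditionally in the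
  `f`-parametrised form), and `p = 3` off that residual population (modulo Deligne for the edge value).
  Nothing about the ENGINE S2–S5 of the line card (not in print / not typed). Calibration of S1 only.

References: Deligne–Serre 1974, 6.9–6.11 [DeligneSerreASENS1974]; Diamond–Shurman GTM 228, §1.2,
Thms. 5.8.2–5.8.3, 5.9.2 [DiamondShurman2005]; Deligne 1974, Thm. 8.2 [Deligne1974];
Breuil–Conrad–Diamond–Taylor 2001, Thm. A [BreuilConradDiamondTaylor2001]; crux workfiles
`Cruxes/KobayashiLowerHalfLargeImage/{Ideas/edge-seed-rigidity.md, Lines/edge_seed_rigidity.md}`.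
-/

set_option autoImplicit false
set_option linter.dupNamespace false

noncomputable section

open scoped MatrixGroups ModularForm

open CongruenceSubgroup UpperHalfPlane WeierstrassCurve
  Literature.NumberTheory.EllipticCurves Literature.NumberTheory.EllipticCurves.ModularForms
  Literature.NumberTheory.EllipticCurves.Rank1Residual

namespace Summit.BirchSwinnertonDyer.BirchSwinnertonDyer.Theorems.EdgeSeedRigidity

/-- **The weight-`4` companion newform of `f_E` at `p ∈ {2, 3}`** (unconditional). Let `W/ℚ` be a
globally minimal elliptic curve of conductor `N`, `p ∣ 24` a prime of good reduction, `f ∈ S_2(Γ₀(N))`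
the newform of `W` (`IsNewformOf W f`), and `M ∣ N` a divisor with `p ∤ (1 − M)` (at `p = 3`:
`M ≢ 1 (mod 3)`). Then there are a level `M′ ∣ N` with `p ∤ M′`, a newform `g ∈ S_4(Γ₀(M′))` and a
field isomorphism `ι : ℚ̄_p ≃ ℂ` such that `‖ι⁻¹(a_ℓ(g)) − a_ℓ(W)‖_p < 1` for every prime `ℓ ∤ N`
(`a_ℓ(g)` the `T_ℓ`-eigenvalue, `a_ℓ(W)` the Frobenius trace). Deligne–Serre 6.9–6.11 run with the
weight-two multiplier `(E₂(τ) − M E₂(Mτ))/(1 − M) ≡ 1 (mod p)` (`exists_isNewform0_dvd_level_congr_weight_add_two`)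
+ Atkin–Lehner–Li + the modularity dictionary.
[cite: DeligneSerreASENS1974, 6.9–6.11] [cite: DiamondShurman2005, §1.2 and Thm. 5.8.3] -/
theorem exists_companion_newform_weight_add_two_of_isNewformOf (W : WeierstrassCurve ℚ) [W.IsElliptic]
    [W.IsGloballyMinimal] [NeZero (W.conductorNorm ℤ)] (p : ℕ) [Fact p.Prime] (hp24 : p ∣ 24)
    (hgood : W.HasGoodReductionAtPrime p)
    {f : CuspForm (Gamma0 (W.conductorNorm ℤ)) 2} (hf : IsNewformOf W f)
    {M : ℕ} (hMN : M ∣ W.conductorNorm ℤ) (hM : ¬ (p : ℤ) ∣ 1 - (M : ℤ)) :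
    ∃ (M' : ℕ) (_ : NeZero M') (_ : M' ∣ W.conductorNorm ℤ) (g : CuspForm (Gamma0 M') (2 + 2))
      (ι : PadicAlgCl p ≃+* ℂ),
      IsNewform0 g ∧ ¬ p ∣ M' ∧
      (∀ ℓ : ℕ, ℓ.Prime → ¬ ℓ ∣ W.conductorNorm ℤ →
        ‖ι.symm (heckeEigenvalue g ℓ) - ((W.frobeniusTrace ℓ : ℤ) : PadicAlgCl p)‖ < 1) := by
  -- an abstract field isomorphism `ℚ̄_p ≃ ℂ`
  obtain ⟨ι⟩ := PadicAlgCl.nonempty_ringEquiv_complex p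
  -- good reduction at `p` forces `p ∤ N`
  have hpN : ¬ p ∣ W.conductorNorm ℤ := not_dvd_level_of_isNewformOf hf hgood
  -- Deligne–Serre with the weight-two multiplier + Atkin–Lehner–Li
  obtain ⟨M', hM', hM'N, g, hg, hcong⟩ :=
    exists_isNewform0_dvd_level_congr_weight_add_two ι hp24 le_rfl hf.1 hMN hM
  refine ⟨M', hM', hM'N, g, ι, hg, fun h => hpN (h.trans hM'N), fun ℓ hℓ hℓN => ?_⟩
  -- the modularity dictionary at the good prime `ℓ ∤ N`: `a_ℓ(f) = a_ℓ(W)`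
  haveI : Fact ℓ.Prime := ⟨hℓ⟩
  have hgoodℓ : W.HasGoodReductionAtPrime ℓ :=
    hasGoodReductionAtPrime_of_not_dvd_conductorNorm W hℓN
  have hfℓ : (qExpansion 1 ⇑f).coeff ℓ = ((W.frobeniusTrace ℓ : ℤ) : ℂ) := by
    rw [← WeierstrassCurve.LFunction_apply_prime_eq_frobeniusTrace W ℓ hgoodℓ]
    exact hf.2 ℓ
  have h := hcong ℓ hℓ hℓN
  rw [hfℓ, map_intCast] at h
  -- `T_ℓ g = a_ℓ(g) g` for the newform `g`
  rw [IsNewform0.heckeEigenvalue_eq_coeff_holds hg hℓ]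
  exact h

/-- **The EDGE companion at `p = 3`, granted Deligne's bound**: for `W/ℚ` globally minimal with good
reduction at `3`, `f` its newform, and a divisor `M ∣ N_W` with `3 ∤ (1 − M)`, there are `M′ ∣ N_W` with
`3 ∤ M′`, a newform `g ∈ S_4(Γ₀(M′))` congruent to `f` modulo `𝔪_{ℚ̄_3}` at every prime `ℓ ∤ N_W`
(through some `ι : ℚ̄_3 ≃ ℂ`), and `L(g, 3) ≠ 0` — the last critical value of `g`, ON the boundary
`re s = k/2 + 1` of Hecke's half-plane, whence Deligne's bound (`Deligne1974_heckeT_eigenvalue_norm_le`,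
through `IsNewform0.cuspFormLSeries_edge_ne_zero_of_deligne`). CONDITIONAL on `hD` only.
[cite: DeligneSerreASENS1974, 6.9–6.11] [cite: Deligne1974, Thm. 8.2]
[cite: DiamondShurman2005, §1.2 and Thm. 5.9.2] -/
theorem exists_companionEdge_of_isNewformOf_three (hD : Deligne1974_heckeT_eigenvalue_norm_le)
    (W : WeierstrassCurve ℚ) [W.IsElliptic] [W.IsGloballyMinimal] [NeZero (W.conductorNorm ℤ)]
    (hgood : W.HasGoodReductionAtPrime 3)
    {f : CuspForm (Gamma0 (W.conductorNorm ℤ)) 2} (hf : IsNewformOf W f)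
    {M : ℕ} (hMN : M ∣ W.conductorNorm ℤ) (hM : ¬ (3 : ℤ) ∣ 1 - (M : ℤ)) :
    ∃ (M' : ℕ) (_ : NeZero M') (_ : M' ∣ W.conductorNorm ℤ)
      (g : CuspForm (Gamma0 M') (((3 : ℕ) : ℤ) + 1)) (ι : PadicAlgCl 3 ≃+* ℂ),
      IsNewform0 g ∧ ¬ 3 ∣ M' ∧
      (∀ ℓ : ℕ, ℓ.Prime → ¬ ℓ ∣ W.conductorNorm ℤ →
        ‖ι.symm (heckeEigenvalue g ℓ) - ((W.frobeniusTrace ℓ : ℤ) : PadicAlgCl 3)‖ < 1) ∧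
      cuspFormLSeries g ((3 : ℕ) : ℂ) ≠ 0 := by
  haveI : Fact (Nat.Prime 3) := ⟨Nat.prime_three⟩
  have hM' : ¬ ((3 : ℕ) : ℤ) ∣ 1 - (M : ℤ) := by exact_mod_cast hM
  obtain ⟨M', hM'0, hM'N, g, ι, hg, h3M', hcong⟩ :=
    exists_companion_newform_weight_add_two_of_isNewformOf W 3 (by norm_num) hgood hf hMN hM'
  have hk : (2 : ℤ) + 2 = ((3 : ℕ) : ℤ) + 1 := by norm_num
  rw [← hk]
  refine ⟨M', hM'0, hM'N, g, ι, hg, h3M', hcong, ?_⟩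
  -- `L(g, 3) = L(g, k − 1)` with `k = 4`: Deligne's bound at the boundary of Hecke's half-plane
  have h := IsNewform0.cuspFormLSeries_edge_ne_zero_of_deligne hD hg (by norm_num)
  have hs : (((2 : ℤ) + 2 : ℤ) : ℂ) - 1 = ((3 : ℕ) : ℂ) := by push_cast; ring
  rwa [hs] at h

/-- **`stub_companionEdge` of the line card `Lines/edge_seed_rigidity.md` AT `p = 3`, on the curves with a
conductor divisor `M ≢ 1 (mod 3)`, granted the Modularity Theorem and Deligne's bound.** The ideator's stub
(evidence `Sketch.lean` of item 19001, crux-ideate k1 g14) reads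
`∀ W p, p ≠ 2 → ClassX7 W p → a_p = 0 → Surj W p → ∃ M g, IsCompanionForm p W g ∧ L(g, p) ≠ 0` with
`IsCompanionForm p W g := IsNewform0 g ∧ ¬ p ∣ M ∧ M ∣ N_W ∧ IsCongruentFormModP p W g` and
`IsCongruentFormModP p W g := ∃ (ι : ℚ̄_p →+* ℂ) (b : ℕ → ℚ̄_p), ∀ ℓ prime, ℓ ∤ p·M·N_W →
ι (b ℓ) = heckeEigenvalue g ℓ ∧ ‖b ℓ − a_ℓ(W)‖ < 1`; here both definitions are UNFOLDED (as in
`stub_companionEdge_of_five_le_of_exists_isNewformOf`), `p ≠ 2` is specialised to `p = 3`, and the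
population hypothesis `∃ M ∣ N_W, 3 ∤ (1 − M)` is ADDED (on its complement — every bad prime `≡ 1 (mod 3)`
— the weight-`4` companion needs the Hasse invariant, not in the tree; see the module docstring). Inputs
beyond proved theorems: the named facts `exists_isNewformOf` (Breuil–Conrad–Diamond–Taylor 2001, Thm. A;
the stub does not name the newform of `W`) and `Deligne1974_heckeT_eigenvalue_norm_le` (Deligne 1974,
Thm. 8.2; `L(g, 3)` lies on Hecke's boundary). `ClassX7 W p` is used only through good reduction at `p`;
the displayed `a_p = 0`, `Surj W p` are idle. CONDITIONAL on `hmod`, `hD`; calibration of S1 only — the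
line's engine S2 is not in print. [cite: BreuilConradDiamondTaylor2001, Thm. A]
[cite: DeligneSerreASENS1974, 6.9–6.11] [cite: Deligne1974, Thm. 8.2]
[cite: DiamondShurman2005, §1.2 and Thm. 5.9.2] -/
theorem stub_companionEdge_three_of_exists_isNewformOf (hmod : exists_isNewformOf)
    (hD : Deligne1974_heckeT_eigenvalue_norm_le) :
    ∀ (W : WeierstrassCurve ℚ) [W.IsElliptic] [W.IsGloballyMinimal] (p : ℕ) [Fact p.Prime],
      p = 3 → ClassX7 W p → W.frobeniusTrace p = 0 → Surj W p →
      (∃ M : ℕ, M ∣ W.conductorNorm ℤ ∧ ¬ (p : ℤ) ∣ 1 - (M : ℤ)) →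
      ∃ (M : ℕ) (_ : NeZero M) (g : CuspForm (Gamma0 M) ((p : ℤ) + 1)),
        (IsNewform0 g ∧ ¬ (p ∣ M) ∧ M ∣ W.conductorNorm ℤ ∧
          ∃ (ι : PadicAlgCl p →+* ℂ) (b : ℕ → PadicAlgCl p),
            ∀ ℓ : ℕ, ℓ.Prime → ¬ (ℓ ∣ p * M * W.conductorNorm ℤ) →
              ι (b ℓ) = heckeEigenvalue g ℓ ∧
                ‖b ℓ - (W.frobeniusTrace ℓ : PadicAlgCl p)‖ < 1) ∧
        cuspFormLSeries g (p : ℂ) ≠ 0 := by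
  intro W _ _ p _ hp3 hX _ _ hpop
  subst hp3
  haveI : NeZero (W.conductorNorm ℤ) := ⟨(W.conductorNorm_pos_holds : 0 < W.conductorNorm ℤ).ne'⟩
  obtain ⟨M, hMN, hM⟩ := hpop
  have hM3 : ¬ (3 : ℤ) ∣ 1 - (M : ℤ) := by exact_mod_cast hM
  -- modularity: the newform `f_W`
  obtain ⟨f, hf⟩ := hmod W
  obtain ⟨M', hM'0, hM'N, g, ι, hg, h3M', hcong, hL⟩ :=
    exists_companionEdge_of_isNewformOf_three hD W hX.1.1 hf hMN hM3
  refine ⟨M', hM'0, g, ⟨hg, h3M', hM'N, (ι : PadicAlgCl 3 →+* ℂ), fun ℓ => ι.symm (heckeEigenvalue g ℓ),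
    fun ℓ hℓ hℓpMN => ⟨?_, ?_⟩⟩, hL⟩
  · -- `ι (ι⁻¹ a_ℓ(g)) = a_ℓ(g)`
    exact ι.apply_symm_apply _
  · -- `ℓ ∤ 3·M′·N ⇒ ℓ ∤ N`
    exact hcong ℓ hℓ fun h => hℓpMN (h.mul_left (3 * M'))

/-! ### Appendix (2026-08-28, same seat): the edge clause made UNCONDITIONAL

After this file landed, `CuspFormLFunctionMeanSquareNonvanishingProofs` (seat slh-p1-w8) proved
`IsNewform0.cuspFormLSeries_edge_ne_zero` — `L(f, k − 1) ≠ 0` for every `Γ₀(N)`-newform of weight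
`k ≥ 4` — WITHOUT Deligne's bound (Rankin's mean square gives absolute convergence on `re s > (k+1)/2`).
The two theorems below are the Deligne-free forms of `exists_companionEdge_of_isNewformOf_three` and
`stub_companionEdge_three_of_exists_isNewformOf` (same statements, the binder `hD` deleted); the
originals are kept (append-only). -/

/-- **The EDGE companion at `p = 3`, UNCONDITIONAL**: for `W/ℚ` globally minimal with good reduction
at `3`, `f` its newform, and a divisor `M ∣ N_W` with `3 ∤ (1 − M)`, there are `M′ ∣ N_W` with `3 ∤ M′`,
a newform `g ∈ S_4(Γ₀(M′))` congruent to `f` modulo `𝔪_{ℚ̄_3}` at every prime `ℓ ∤ N_W` (through some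
`ι : ℚ̄_3 ≃ ℂ`), and `L(g, 3) ≠ 0` — the edge value by `IsNewform0.cuspFormLSeries_edge_ne_zero`
(Rankin's half-plane `re s > (k+1)/2 = 5/2`), no Deligne bound. Deligne-free form of
`exists_companionEdge_of_isNewformOf_three`. [cite: DeligneSerreASENS1974, 6.9–6.11]
[cite: DiamondShurman2005, §1.2 and Thm. 5.9.2] -/
theorem exists_companionEdge_of_isNewformOf_three'
    (W : WeierstrassCurve ℚ) [W.IsElliptic] [W.IsGloballyMinimal] [NeZero (W.conductorNorm ℤ)]
    (hgood : W.HasGoodReductionAtPrime 3)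
    {f : CuspForm (Gamma0 (W.conductorNorm ℤ)) 2} (hf : IsNewformOf W f)
    {M : ℕ} (hMN : M ∣ W.conductorNorm ℤ) (hM : ¬ (3 : ℤ) ∣ 1 - (M : ℤ)) :
    ∃ (M' : ℕ) (_ : NeZero M') (_ : M' ∣ W.conductorNorm ℤ)
      (g : CuspForm (Gamma0 M') (((3 : ℕ) : ℤ) + 1)) (ι : PadicAlgCl 3 ≃+* ℂ),
      IsNewform0 g ∧ ¬ 3 ∣ M' ∧
      (∀ ℓ : ℕ, ℓ.Prime → ¬ ℓ ∣ W.conductorNorm ℤ →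
        ‖ι.symm (heckeEigenvalue g ℓ) - ((W.frobeniusTrace ℓ : ℤ) : PadicAlgCl 3)‖ < 1) ∧
      cuspFormLSeries g ((3 : ℕ) : ℂ) ≠ 0 := by
  haveI : Fact (Nat.Prime 3) := ⟨Nat.prime_three⟩
  have hM' : ¬ ((3 : ℕ) : ℤ) ∣ 1 - (M : ℤ) := by exact_mod_cast hM
  obtain ⟨M', hM'0, hM'N, g, ι, hg, h3M', hcong⟩ :=
    exists_companion_newform_weight_add_two_of_isNewformOf W 3 (by norm_num) hgood hf hMN hM'
  have hk : (2 : ℤ) + 2 = ((3 : ℕ) : ℤ) + 1 := by norm_num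
  rw [← hk]
  refine ⟨M', hM'0, hM'N, g, ι, hg, h3M', hcong, ?_⟩
  -- `L(g, 3) = L(g, k − 1)` with `k = 4`: Rankin's half-plane, unconditional
  have h := IsNewform0.cuspFormLSeries_edge_ne_zero hg (by norm_num)
  have hs : (((2 : ℤ) + 2 : ℤ) : ℂ) - 1 = ((3 : ℕ) : ℂ) := by push_cast; ring
  rwa [hs] at h

/-- **`stub_companionEdge` of the line card `Lines/edge_seed_rigidity.md` AT `p = 3`, on the curves with a
conductor divisor `M ≢ 1 (mod 3)`, granted the Modularity Theorem ONLY.** The ideator's stub body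
VERBATIM (definitions of `Sketch.lean` unfolded as in `stub_companionEdge_of_five_le_of_exists_isNewformOf`),
`p ≠ 2` specialised to `p = 3`, the population hypothesis `∃ M ∣ N_W, 3 ∤ (1 − M)` ADDED; the edge value
`L(g, 3) ≠ 0` is now UNCONDITIONAL (`IsNewform0.cuspFormLSeries_edge_ne_zero`), so the only input beyond
proved theorems is `exists_isNewformOf` (Breuil–Conrad–Diamond–Taylor 2001, Thm. A; the stub does not
name the newform of `W`). `ClassX7 W p` is used only through good reduction at `p`; `a_p = 0`, `Surj W p`
are idle. Deligne-free form of `stub_companionEdge_three_of_exists_isNewformOf`. CONDITIONAL on `hmod`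
only; calibration of S1 — the line's engine S2 is not in print.
[cite: BreuilConradDiamondTaylor2001, Thm. A] [cite: DeligneSerreASENS1974, 6.9–6.11]
[cite: DiamondShurman2005, §1.2 and Thm. 5.9.2] -/
theorem stub_companionEdge_three_of_exists_isNewformOf' (hmod : exists_isNewformOf) :
    ∀ (W : WeierstrassCurve ℚ) [W.IsElliptic] [W.IsGloballyMinimal] (p : ℕ) [Fact p.Prime],
      p = 3 → ClassX7 W p → W.frobeniusTrace p = 0 → Surj W p →
      (∃ M : ℕ, M ∣ W.conductorNorm ℤ ∧ ¬ (p : ℤ) ∣ 1 - (M : ℤ)) →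
      ∃ (M : ℕ) (_ : NeZero M) (g : CuspForm (Gamma0 M) ((p : ℤ) + 1)),
        (IsNewform0 g ∧ ¬ (p ∣ M) ∧ M ∣ W.conductorNorm ℤ ∧
          ∃ (ι : PadicAlgCl p →+* ℂ) (b : ℕ → PadicAlgCl p),
            ∀ ℓ : ℕ, ℓ.Prime → ¬ (ℓ ∣ p * M * W.conductorNorm ℤ) →
              ι (b ℓ) = heckeEigenvalue g ℓ ∧
                ‖b ℓ - (W.frobeniusTrace ℓ : PadicAlgCl p)‖ < 1) ∧
        cuspFormLSeries g (p : ℂ) ≠ 0 := by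
  intro W _ _ p _ hp3 hX _ _ hpop
  subst hp3
  haveI : NeZero (W.conductorNorm ℤ) := ⟨(W.conductorNorm_pos_holds : 0 < W.conductorNorm ℤ).ne'⟩
  obtain ⟨M, hMN, hM⟩ := hpop
  have hM3 : ¬ (3 : ℤ) ∣ 1 - (M : ℤ) := by exact_mod_cast hM
  -- modularity: the newform `f_W`
  obtain ⟨f, hf⟩ := hmod W
  obtain ⟨M', hM'0, hM'N, g, ι, hg, h3M', hcong, hL⟩ :=
    exists_companionEdge_of_isNewformOf_three' W hX.1.1 hf hMN hM3
  refine ⟨M', hM'0, g, ⟨hg, h3M', hM'N, (ι : PadicAlgCl 3 →+* ℂ), fun ℓ => ι.symm (heckeEigenvalue g ℓ),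
    fun ℓ hℓ hℓpMN => ⟨?_, ?_⟩⟩, hL⟩
  · -- `ι (ι⁻¹ a_ℓ(g)) = a_ℓ(g)`
    exact ι.apply_symm_apply _
  · -- `ℓ ∤ 3·M′·N ⇒ ℓ ∤ N`
    exact hcong ℓ hℓ fun h => hℓpMN (h.mul_left (3 * M'))

/-- **The weight-`4` companion at `p = 3` is `3`-adically NON-ORDINARY on the crux's class** (uses the
displayed hypothesis `a_3(W) = 0` of the crux, idle in S1 itself): for `W/ℚ` globally minimal with good
SUPERSINGULAR reduction at `3` (`a_3(W) = 0`), `f` its newform and a divisor `M ∣ N_W` with `3 ∤ (1 − M)`,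
the companion `g ∈ S_4(Γ₀(M′))`, `M′ ∣ N_W`, `3 ∤ M′`, of `exists_companionEdge_of_isNewformOf_three'`
satisfies in addition `‖ι⁻¹(a_3(g))‖_3 < 1` — its `T_3`-eigenvalue lies in the maximal ideal, i.e. `g` is a
non-ordinary point of weight `4` (the locus of S4/S5 of the line card: Kato's Thm. 12.5 at a non-ordinary
form, Fouquet's transport through the non-ordinary locus) — together with the congruence at every prime
`ℓ ∤ N_W` and `L(g, 3) ≠ 0`, all UNCONDITIONAL. The congruence at `ℓ = 3` (`3 ∤ N_W` at a good prime)
read against `a_3(W) = 0`. [cite: DeligneSerreASENS1974, 6.9–6.11] [cite: DiamondShurman2005, §1.2 and Thm. 5.9.2] -/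
theorem exists_companionEdge_nonordinary_of_isNewformOf_three
    (W : WeierstrassCurve ℚ) [W.IsElliptic] [W.IsGloballyMinimal] [NeZero (W.conductorNorm ℤ)]
    (hgood : W.HasGoodReductionAtPrime 3) (hss : W.frobeniusTrace 3 = 0)
    {f : CuspForm (Gamma0 (W.conductorNorm ℤ)) 2} (hf : IsNewformOf W f)
    {M : ℕ} (hMN : M ∣ W.conductorNorm ℤ) (hM : ¬ (3 : ℤ) ∣ 1 - (M : ℤ)) :
    ∃ (M' : ℕ) (_ : NeZero M') (_ : M' ∣ W.conductorNorm ℤ)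
      (g : CuspForm (Gamma0 M') (((3 : ℕ) : ℤ) + 1)) (ι : PadicAlgCl 3 ≃+* ℂ),
      IsNewform0 g ∧ ¬ 3 ∣ M' ∧
      (∀ ℓ : ℕ, ℓ.Prime → ¬ ℓ ∣ W.conductorNorm ℤ →
        ‖ι.symm (heckeEigenvalue g ℓ) - ((W.frobeniusTrace ℓ : ℤ) : PadicAlgCl 3)‖ < 1) ∧
      ‖ι.symm (heckeEigenvalue g 3)‖ < 1 ∧
      cuspFormLSeries g ((3 : ℕ) : ℂ) ≠ 0 := by
  haveI : Fact (Nat.Prime 3) := ⟨Nat.prime_three⟩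
  obtain ⟨M', hM'0, hM'N, g, ι, hg, h3M', hcong, hL⟩ :=
    exists_companionEdge_of_isNewformOf_three' W hgood hf hMN hM
  refine ⟨M', hM'0, hM'N, g, ι, hg, h3M', hcong, ?_, hL⟩
  -- `3 ∤ N_W` (good reduction), so the congruence applies at `ℓ = 3`, where `a_3(W) = 0`
  have h3N : ¬ 3 ∣ W.conductorNorm ℤ := not_dvd_level_of_isNewformOf hf hgood
  have h := hcong 3 Nat.prime_three h3N
  rwa [hss, Int.cast_zero, sub_zero] at h

end Summit.BirchSwinnertonDyer.BirchSwinnertonDyer.Theorems.EdgeSeedRigidity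

end
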